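/-
Copyright (c) 2026 the pub-hodgecm-mathlib formalisation cell (harness21).  Prover seat hodgecm-mathlib-K2E3-p32 (g0), HCML Track B «K2-LIT» (close-out strike line L4
`stub_StCharTS`), h413 = `stmt-HodgeConjecture-24833`, line `K2_E3_EllipticInputs`, unit U4 «Keys», PART «U4Keys» socket :155 (U4f-χ₁-ram-one-d0B)
`sig_K2E3KeysThmTwoContractingRamifiedCharOneDepthZeroNormTrivial` (LINE-LEAD K2E3-plan (g5), deal D162, cell «U4-RAM»; plan of record K2E3-p06 (g4) DESIGN-M2-v2 (O2) ∕
PAPER-Z3-DepthZeroInert §1–§2; Z3-c SHARED FRAME v1 (K2E3-p03 (g9)) constants `Y, q, V, ε₀, c`), step Z3-d «THE FOUR ENTRIES AND `det M = 0` GIVE `Y = −1∕q`» — generic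
algebra over `ℂ`, the socket between the Z3 values ((II)-c ∕ ★ PairConstants ∕ ★ HaarFactsN) and ★ Z4 `K2E3BranchBDeterminantRoots`.  2026-09-04.
-/
import Summits.HodgeConjecture.HodgeConjecture.Theorems.K2E3BranchBDeterminantRoots   -- ★ Z4 (K2E3-p06 (g4)): `det_eq_zero_iff_of_norm_lt_one`
import Mathlib.Tactic.LinearCombination
import HarnessLib

/-!
# K2 ∕ E3 «EllipticInputs», unit U4 «Keys» — (U4f-χ₁-ram-one-d0B) step Z3-d (algebra): THE FOUR CASSELMAN-PAIR ENTRIES IN THE FRAME-v1 LETTERS `Y, q, V, ε₀` (and the sign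
# `c₂ = χ₂(−1)`), TOGETHER WITH `det M = 0` AND `V ≠ 0`, FORCE `Y = −1∕q` ON THE DISC `|Y| < 1`
# [Keys1984 §7 Thm (2); Casselman1980 §3; PAPER-Z3-DepthZeroInert §1–§2 (K2E3-p06 (g4), r01-screened)]

Cell `pub/hodgecm-mathlib`, crux H413 = `stmt-HodgeConjecture-24833`, route of record `HCCMUnconditional`; chair K2-lead (g2), LINE-LEAD∕dealer K2E3-plan (g5), architect K2E3-p25
(g3); cell «U4-RAM» (Z3-c frame v1, K2E3-p03 (g9)).  THEOREMS ONLY (no `def`, no `instance`, no `notation`, no named-fact hypothesis, no `sorry`); lane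
`--supports stmt-HodgeConjecture-24833 --as helper`, count-neutral.  NOT THE PAYER.

THE POINT.  The d0B end assembly (this seat, consumer of the «U4-RAM» chain) receives FOUR NUMBERS for the normalised `(I, χ̃)`-type basis `(f₁, f_w)` of `i(χ₁, 1)`, in the letters
of the Z3-c SHARED FRAME v1 (`Y = χ₁(ϖ̂)`, `q = N𝔭_v`, `V = μ(N₀)`, `ε₀ = χ₁(δ₀)` with `ε₀² = 1`, and the sign `c₂ = χ₂(−1)`, `c₂² = 1`; here `χ₂ = 1`, `c₂ = 1`):
`Λ_1 f₁ = c₂·ε₀·((q−1)∕q²)·V·Y∕(1+Y)` and `Λ_{w₀} f_w = −c₂·ε₀·((q−1)∕q²)·V∕(1+Y)` ((II)-c `K2E3BranchBCasselmanPairEntries`, R90-C10-p01), `Λ_1 f_w = V` (★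
`K2E3BranchBCasselmanPairConstants.integral_toFun_weyl_mul_eq`, K2E3-p03) and `Λ_{w₀} f₁ = q⁻³·V` (★ ibid. `integral_toFun_conj_eq` + ★ `K2E3BranchBHaarFactsN.measureReal_setOf_conj_mem_eq`,
R90-C10-p04); and ★ Z2-B (`K2E3BranchBDeterminantZeroDepthZero`, this seat) gives `det M = Λ_1 f₁ · Λ_{w₀} f_w − Λ_1 f_w · Λ_{w₀} f₁ = 0` when `i(χ₁, 1)` is reducible.  THIS FILE is
the algebra in between: substituting, `det M = V²·(−(q−1)²q⁻⁴·Y∕(1+Y)² − q⁻³)` (using `c₂² = ε₀² = 1`), so `V ≠ 0` and ★ Z4 `det_eq_zero_iff_of_norm_lt_one` (`|Y| < 1 < q`) give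
**`Y = −1∕q`** — the input `hY` of ★ Z5 `K2E3KeysThmTwoDepthZeroBranchBConversion.exists_eta_of_branchB_of_apply_uniformizer_eq_neg_inv_absNorm` (this seat).
* `det_letters_eq` — the substitution identity `Λ_1 f₁ · Λ_{w₀} f_w − Λ_1 f_w · Λ_{w₀} f₁ = V² · (−(q−1)²q⁻⁴·Y∕(1+Y)² − q⁻³)`.
* **`eq_neg_inv_of_det_eq_zero`** — the four entries, `det M = 0`, `V ≠ 0`, `|Y| < 1 < q` ⟹ `Y = −q⁻¹`.
HONEST LABEL.  HC_CM is proved only modulo the 7 printed citations (2 remaining named inputs: hLiu418 = `stmt-HodgeConjecture-24832`, h413 = `stmt-HodgeConjecture-24833`) until rung 0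
closes; count-neutral — this file does NOT pay the leaf; no printed citation is discharged.

## References
* [Keys1984] D. Keys, Compositio Math. 51 (1984), §7 Theorem (2) p. 126 (the reducibility points `s = ½`, `λ|_{Fˣ} = ω`).
* [Casselman1980] W. Casselman, Compositio Math. 40 (1980), §3 (the matrix of the intertwining functionals on the Iwahori-type vectors).
* [Rogawski1990] J. Rogawski, Ann. of Math. Stud. 123 (1990), §12.2 (1)–(2) p. 173.
-/

set_option autoImplicit false
-- the mandated namespace has the single-problem summit's repeated segment (`HodgeConjecture.HodgeConjecture`)
set_option linter.dupNamespace false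

namespace Summit.HodgeConjecture.HodgeConjecture.Cruxes.H413.K2E3BranchBDeterminantLettersToRoot

open Summit.HodgeConjecture.HodgeConjecture.Cruxes.H413

/-! ## §1 The substitution identity -/

/-- **`det M` in the frame-v1 letters.**  With `Λ_1 f₁ = c₂·(ε₀·((q−1)∕q²)·V·Y∕(1+Y))`, `Λ_{w₀} f_w = −c₂·(ε₀·((q−1)∕q²)·V∕(1+Y))`, `Λ_1 f_w = V`, `Λ_{w₀} f₁ = (q³)⁻¹·V` and
`ε₀² = c₂² = 1`: `Λ_1 f₁ · Λ_{w₀} f_w − Λ_1 f_w · Λ_{w₀} f₁ = V² · (−(q−1)²(q⁴)⁻¹·Y·((1+Y)²)⁻¹ − (q³)⁻¹)` — the left factor of ★ Z4 `det_formula_eq` times `V²` (PAPER-Z3 §2: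
`det M = G₁G₂ − vol(N₀)·vol(N(𝔭))`). [cite: Keys1984, §7 Theorem (2) p. 126] [cite: Casselman1980, §3] -/
theorem det_letters_eq (q Y ε₀ c₂ V Λ11 Λ1w Λw1 Λww : ℂ) (hε : ε₀ ^ 2 = 1) (hc : c₂ ^ 2 = 1)
    (h11 : Λ11 = c₂ * (ε₀ * ((q - 1) / q ^ 2) * V * Y / (1 + Y))) (hww : Λww = -(c₂ * (ε₀ * ((q - 1) / q ^ 2) * V / (1 + Y))))
    (hw1 : Λw1 = V) (h1w : Λ1w = (q ^ 3)⁻¹ * V) :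
    Λ11 * Λww - Λw1 * Λ1w = V ^ 2 * (-(q - 1) ^ 2 * (q ^ 4)⁻¹ * Y * ((1 + Y) ^ 2)⁻¹ - (q ^ 3)⁻¹) := by
  rw [h11, hww, hw1, h1w]
  -- `ring` inverts monomials in `q` but keeps `(1 + Y)⁻¹` and `((1 + Y)²)⁻¹` as unrelated atoms: relate them once
  have hY2 : (1 + Y)⁻¹ * (1 + Y)⁻¹ = ((1 + Y) ^ 2)⁻¹ := by rw [← mul_inv, ← pow_two]
  simp only [div_eq_mul_inv]
  linear_combination (-(((q - 1) ^ 2 * V ^ 2 * Y) * ((q ^ 2)⁻¹ * (q ^ 2)⁻¹) * ((1 + Y)⁻¹ * (1 + Y)⁻¹)) * ε₀ ^ 2) * hc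
    + (-(((q - 1) ^ 2 * V ^ 2 * Y) * ((q ^ 2)⁻¹ * (q ^ 2)⁻¹) * ((1 + Y)⁻¹ * (1 + Y)⁻¹))) * hε
    + (-((q - 1) ^ 2 * V ^ 2 * Y * (q ^ 4)⁻¹)) * hY2

/-! ## §2 `det M = 0`, `V ≠ 0`, `|Y| < 1 < q` ⟹ `Y = −1∕q` -/

/-- **THE ROOT FROM THE FOUR ENTRIES.**  For real `q > 1`, `|Y| < 1`, `ε₀² = c₂² = 1`, `V ≠ 0` and the four entries as in `det_letters_eq`: `det M = 0` forces **`Y = −q⁻¹`** (★ Z4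
`det_eq_zero_iff_of_norm_lt_one` after dividing by `V²`).  In the d0B assembly: `q = N𝔭_v`, `Y = χ₁(ϖ̂)`, `V = μ(N₀) > 0`, `ε₀ = χ₁(δ₀)`, `c₂ = χ₂(−1) = 1`; the output is the `hY` of ★ Z5
`exists_eta_of_branchB_of_apply_uniformizer_eq_neg_inv_absNorm`. [cite: Keys1984, §7 Theorem (2) p. 126] [cite: Casselman1980, §3] [cite: Rogawski1990, §12.2 (1)–(2) p. 173] -/
theorem eq_neg_inv_of_det_eq_zero (q : ℝ) (hq : 1 < q) (Y ε₀ c₂ V Λ11 Λ1w Λw1 Λww : ℂ) (hY : ‖Y‖ < 1)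
    (hε : ε₀ ^ 2 = 1) (hc : c₂ ^ 2 = 1) (hV : V ≠ 0)
    (h11 : Λ11 = c₂ * (ε₀ * (((q : ℂ) - 1) / (q : ℂ) ^ 2) * V * Y / (1 + Y))) (hww : Λww = -(c₂ * (ε₀ * (((q : ℂ) - 1) / (q : ℂ) ^ 2) * V / (1 + Y))))
    (hw1 : Λw1 = V) (h1w : Λ1w = ((q : ℂ) ^ 3)⁻¹ * V)
    (hdet : Λ11 * Λww - Λw1 * Λ1w = 0) :
    Y = -(q : ℂ)⁻¹ := by
  rw [det_letters_eq (q : ℂ) Y ε₀ c₂ V Λ11 Λ1w Λw1 Λww hε hc h11 hww hw1 h1w] at hdet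
  have h := (mul_eq_zero.1 hdet).resolve_left (pow_ne_zero 2 hV)
  exact (K2E3BranchBDeterminantRoots.det_eq_zero_iff_of_norm_lt_one q hq Y hY).1 h

end Summit.HodgeConjecture.HodgeConjecture.Cruxes.H413.K2E3BranchBDeterminantLettersToRoot
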